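import Summits.QuantumFields.BalabanUV.T4Continuum.Support.DirichletCutoutSplit
import Summits.QuantumFields.BalabanUV.T4Continuum.Support.DirichletVertexDecaySum
import Summits.QuantumFields.BalabanUV.T4Continuum.Support.DirichletCutoutVertices

/-!
# `BalabanUV.T4Continuum.Support.DirichletCutoutNearDecay` — NE2 (node U1a) formalisation swarm, sub-row `T4-U1a.S-NE2-D1-DIRICHLET°`, supplier item
# «Δ1-SKELETON» (file 18): THE NEAR PART DECAYS (`d = 3`) and THE SECOND-DIFFERENCE BUDGET ON EVERY UNION OF BLOCKS — the local energy `Eloc`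
# and local mass `Mloc` of the region Dirichlet solution on the corner cut-out are dominated, through the active-vertex cover (file 17), the
# vertex cubes (files 14–15) and the vertex-sum Morrey decay (file 16), by `θ_3^J·C·‖w‖²`; inserted in THE SPLIT (file 13) this gives, for EVERY
# block set `S`, every axis `μ` and every datum `w`, `‖∂_μᴴ∂_μ v‖² ≤ (16n·A₁A₂ + 16n²·θ_3^J·Cdec·(1 + 3·9·ell1C²·n₀(n₀+1)))·‖w‖²`
# with free scale parameters `R, R′, m, J` (unit b2b-balaban-t4-ne2-formalise-leaf-08, gen 7, file 18)

HONEST FRAMING.  Rung (B)+1 estimate at MODEL level (U = 1 scalar `Δ′ = Δ + a′Π′`, finite torus, `d = 3`); [folklore]; NE2 (U1a) is NOT proved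
by this file; spine PROVED 0/9 unchanged; NOT `d = 4` (mixed edges need the tube decay), NOT infinite volume, NOT the mass gap, NOT Clay.  HONEST
DEPENDENCY (verbatim): «continuum YM on T⁴ ⇐ BetaPertH ∧ nine spine estimates (0/9 proved); BetaPertH ⇐ (D1) ∧ (D4) ∧ CAP+tail; G-an2-4 gates
asym, D1 and NE2/3/4.»

WHAT THIS FILE PROVES (0 sorry; files 10, 12, 13, 14, 15, 16, 17 BY NAME).  `Cdec` (data), `ite_etaC_add_le`, `ite_etaC_le`, **`Eloc_le`**, **`Mloc_le`**,
and the END **`nsq_sdiffH_sdiff_solExt_le_budget`**.  The choice of `R, R′, m, J` along the tower (geometric rate) is NOT made here (next file).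

ABSOLUTE RULE (cell, verbatim): «No internally-minted statement may enter as a cited fact. Every hypothesis is either kernel-proved in
this package or a verbatim quotation of a PUBLISHED theorem with page reference. The manuscript(s) under audit are NOT citable for
their own disputed steps — they are the thing under adjudication; programme-internal (2001/route/tribunal) claims are never citable.»
[folklore]; one data definition; no `def … : Prop` fact.  NOT CLAIMED: the two-level law / tower rate (next file), `d = 4`, NE2, NE3.
-/

noncomputable section

open scoped BigOperators ComplexConjugate Matrix
open Finset

namespace Summit.QuantumFields.BalabanUV.T4Continuum.DirichletCutoutNearDecay

open Literature.MathematicalPhysics.QuantumFieldTheory.Balaban1983to89.B5Prop11Plancherel (Tor fine unitVec)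
open Literature.MathematicalPhysics.QuantumFieldTheory.Balaban1983to89.B5Action121 (sdiff)
open Literature.MathematicalPhysics.QuantumFieldTheory.Balaban1983to89.B5Prop11Lower (nsq nsq_nonneg)
open Summit.QuantumFields.BalabanUV.Beta.GAN24.DirichletBoxTrace (blockReg)
open Summit.QuantumFields.BalabanUV.Beta.GAN24.DirichletBoxCompression (solExt solExt_apply_of_not)
open Summit.QuantumFields.BalabanUV.T4Continuum.ScalarAveragedPropagator (gammaPs gammaPs_pos)
open Summit.QuantumFields.BalabanUV.T4Continuum.CoordSlabPoincare (dirOn)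
open Summit.QuantumFields.BalabanUV.T4Continuum.DirichletHoleFillingCutoff (chart)
open Summit.QuantumFields.BalabanUV.T4Continuum.DirichletHoleFilling (theta theta_lt_one)
open Summit.QuantumFields.BalabanUV.T4Continuum.DirichletCornerCutoutEta (etaC ell1C)
open Summit.QuantumFields.BalabanUV.T4Continuum.DirichletCornerCutoutCover (NC_sub)
open Summit.QuantumFields.BalabanUV.T4Continuum.DirichletCutoutFarPart (A1 A2)
open Summit.QuantumFields.BalabanUV.T4Continuum.DirichletCutoutNearLocal (exists_NC_of_etaC_ne_zero)
open Summit.QuantumFields.BalabanUV.T4Continuum.DirichletCutoutSplit (Eloc Mloc nsq_sdiffH_sdiff_solExt_le_split)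
open Summit.QuantumFields.BalabanUV.T4Continuum.DirichletVertexCubes (NearVtx vtxBase nearVtx_mono sum_nearVtx_le_dirOn)
open Summit.QuantumFields.BalabanUV.T4Continuum.DirichletVertexCover (sum_nearVtx_normSq_le_dirOn)
open Summit.QuantumFields.BalabanUV.T4Continuum.DirichletVertexDecaySum (sum_local_energy_decay_solExt dirOn_nonneg')
open Summit.QuantumFields.BalabanUV.T4Continuum.DirichletCutoutVertices (ActV sigAct sigAct_spec exists_nearVtx_of_NC)

variable {d : ℕ} {n : ℕ} [NeZero n] {M : Fin d → ℕ} [hM : ∀ μ, NeZero (M μ)]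

/-- `NearVtx` is decidable. [folklore] -/
instance decNearVtx (r : ℕ) (β' : Tor M) : DecidablePred (NearVtx n M r β') := fun y => by
  unfold NearVtx; infer_instance

/-- the decay constant `2^d·(γ′⁻¹ + 32(1+2^d)(1+(a′γ′⁻¹)²))` of file 16. [folklore] -/
def Cdec (d : ℕ) (a' : ℝ) : ℝ := 2 ^ d * ((gammaPs d a')⁻¹ + 32 * (1 + 2 ^ d) * (1 + (a' * (gammaPs d a')⁻¹) ^ 2))

/-- `Cdec ≥ 0`. [folklore] -/
theorem Cdec_nonneg (d : ℕ) (a' : ℝ) : 0 ≤ Cdec d a' := by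
  have := (gammaPs_pos (d := d) (a' := a')).1
  unfold Cdec; positivity

section Cover

variable {S : Tor M → Prop} [DecidablePred S] {μ : Fin d} {R R' : ℕ} (hd : d = 3) (hR : 2 ≤ R) (hρn : R' + R + 2 ≤ n)
include hd hR hρn

/-- **pointwise cover, shifted**: `[etaC(x + e_ν) ≠ 0]·G ≤ Σ_{β′ ∈ ActV} [NearVtx (R′+R+2) β′ x]·G` (`G ≥ 0`, `d = 3`). [folklore] -/
theorem ite_etaC_add_le (x : Tor (fine n M)) (ν : Fin d) {G : ℝ} (hG : 0 ≤ G) :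
    (if etaC n M S μ R R' (x + unitVec (fine n M) ν) ≠ 0 then G else 0)
      ≤ ∑ β' ∈ ActV M S, (if NearVtx n M (R' + R + 2) β' x then G else 0) := by
  by_cases h : etaC n M S μ R R' (x + unitVec (fine n M) ν) ≠ 0
  · obtain ⟨β, κ₁, κ₂, hidx, hNC⟩ := exists_NC_of_etaC_ne_zero hR h
    have hNC' := NC_sub hρn ν hNC
    rw [add_sub_cancel_right] at hNC'
    obtain ⟨β', hβ', hnear⟩ := exists_nearVtx_of_NC hd S hidx hNC'
    rw [if_pos h]
    refine le_trans ?_ (Finset.single_le_sum (f := fun β' => if NearVtx n M (R' + R + 2) β' x then G else 0)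
      (fun _ _ => ite_nonneg hG le_rfl) hβ')
    show G ≤ (if NearVtx n M (R' + R + 2) β' x then G else 0)
    rw [if_pos (nearVtx_mono (by omega) hnear)]
  · rw [if_neg h]
    exact Finset.sum_nonneg fun _ _ => ite_nonneg hG le_rfl

omit hρn in
/-- **pointwise cover**: `[etaC x ≠ 0]·G ≤ Σ_{β′ ∈ ActV} [NearVtx (R′+R+2) β′ x]·G`. [folklore] -/
theorem ite_etaC_le (x : Tor (fine n M)) {G : ℝ} (hG : 0 ≤ G) :
    (if etaC n M S μ R R' x ≠ 0 then G else 0) ≤ ∑ β' ∈ ActV M S, (if NearVtx n M (R' + R + 2) β' x then G else 0) := by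
  by_cases h : etaC n M S μ R R' x ≠ 0
  · obtain ⟨β, κ₁, κ₂, hidx, hNC⟩ := exists_NC_of_etaC_ne_zero hR h
    obtain ⟨β', hβ', hnear⟩ := exists_nearVtx_of_NC hd S hidx hNC
    rw [if_pos h]
    refine le_trans ?_ (Finset.single_le_sum (f := fun β' => if NearVtx n M (R' + R + 2) β' x then G else 0)
      (fun _ _ => ite_nonneg hG le_rfl) hβ')
    show G ≤ (if NearVtx n M (R' + R + 2) β' x then G else 0)
    rw [if_pos (nearVtx_mono (by omega) hnear)]
  · rw [if_neg h]
    exact Finset.sum_nonneg fun _ _ => ite_nonneg hG le_rfl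

end Cover

section Decay

variable {S : Tor M → Prop} [DecidablePred S] {μ : Fin d} {R R' : ℕ} (hd : d = 3) (hR : 2 ≤ R) (hρn : R' + R + 2 ≤ n)
  {a' : ℝ} (ha' : 0 < a') {m : ℕ} (hr : R' + R + 4 ≤ 2 * m) (h4m : 4 * m ≤ n) {n₀ : ℕ} (hn₀ : 4 * m = n₀ + 1)
  (J : ℕ) {nn : ℕ} (hnn : 4 * (2 ^ J * m) = nn + 1) (hK : 2 * (2 ^ J * m) ≤ n) (hN' : ∀ ν, nn + 1 ≤ fine n M ν)
include hd hR hρn ha' hr h4m hn₀ hnn hK hN'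

/-- **THE LOCAL ENERGY DECAYS**: `Eloc(v) ≤ θ_d^J·Cdec·‖w‖²` (`d = 3`). [folklore] -/
theorem Eloc_le (w : {x // blockReg n M S x} → ℂ) :
    Eloc n M S μ R R' (solExt n M a' (blockReg n M S) w) ≤ theta d ^ J * Cdec d a' * nsq w := by
  have hd2 : 2 ≤ d := by omega
  have hm : 1 ≤ m := by omega
  have hmK : m ≤ 2 ^ J * m := Nat.le_mul_of_pos_left m (pow_pos (by norm_num) J)
  set v := solExt n M a' (blockReg n M S) w with hv
  have hdec := sum_local_energy_decay_solExt hd2 ha' S (ActV M S) (sigAct M S) (fun β' h => sigAct_spec S h) hm hn₀ J hnn hK hN' w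
  rw [← hv] at hdec
  calc Eloc n M S μ R R' v
      ≤ ∑ ν : Fin d, ∑ x, ∑ β' ∈ ActV M S, (if NearVtx n M (R' + R + 2) β' x then ‖(sdiff (fine n M) (n : ℂ) ν *ᵥ v) x‖ ^ 2 else 0) := by
        unfold Eloc
        exact Finset.sum_le_sum fun ν _ => Finset.sum_le_sum fun x _ => ite_etaC_add_le hd hR hρn x ν (sq_nonneg _)
    _ = ∑ ν : Fin d, ∑ β' ∈ ActV M S, ∑ x, (if NearVtx n M (R' + R + 2) β' x then ‖(sdiff (fine n M) (n : ℂ) ν *ᵥ v) x‖ ^ 2 else 0) :=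
        Finset.sum_congr rfl fun ν _ => Finset.sum_comm
    _ = ∑ β' ∈ ActV M S, ∑ ν : Fin d, ∑ x, (if NearVtx n M (R' + R + 2) β' x then ‖(sdiff (fine n M) (n : ℂ) ν *ᵥ v) x‖ ^ 2 else 0) :=
        Finset.sum_comm
    _ ≤ ∑ β' ∈ ActV M S, (n : ℝ) ^ 2 * dirOn (univ : Finset (Fin d → Fin (n₀ + 1))) (v ∘ chart (fine n M) (n := n₀) (vtxBase n M m (2 ^ J * m) β')) :=
        Finset.sum_le_sum fun β' _ => sum_nearVtx_le_dirOn (n := n) (M := M) hmK h4m hn₀ (r := R' + R + 2) (by omega) β' v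
    _ ≤ theta d ^ J * Cdec d a' * nsq w := by rw [Cdec]; exact hdec

/-- **THE LOCAL MASS DECAYS**: `Mloc(v) ≤ 2d·(1+2^d)·(n₀(n₀+1)/2)/n²·θ_d^J·Cdec·‖w‖²` (`d = 3`). [folklore] -/
theorem Mloc_le (w : {x // blockReg n M S x} → ℂ) :
    Mloc n M S μ R R' (solExt n M a' (blockReg n M S) w)
      ≤ 2 * d * ((1 + 2 ^ d) * ((n₀ : ℝ) * (n₀ + 1) / 2)) / (n : ℝ) ^ 2 * (theta d ^ J * Cdec d a' * nsq w) := by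
  have hd2 : 2 ≤ d := by omega
  have hm : 1 ≤ m := by omega
  have hmK : m ≤ 2 ^ J * m := Nat.le_mul_of_pos_left m (pow_pos (by norm_num) J)
  have hnpos : (0 : ℝ) < n := by exact_mod_cast Nat.pos_of_ne_zero (NeZero.ne n)
  set v := solExt n M a' (blockReg n M S) w with hv
  have hz : ∀ x, ¬ blockReg n M S x → v x = 0 := fun x hx => solExt_apply_of_not n M a' _ w hx
  have hdec := sum_local_energy_decay_solExt hd2 ha' S (ActV M S) (sigAct M S) (fun β' h => sigAct_spec S h) hm hn₀ J hnn hK hN' w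
  rw [← hv] at hdec
  set cP : ℝ := (1 + 2 ^ d) * ((n₀ : ℝ) * (n₀ + 1) / 2) with hcP
  have hcP0 : 0 ≤ cP := by rw [hcP]; positivity
  -- the local mass near one active vertex
  have hone : ∀ β' ∈ ActV M S, ∑ x, (if NearVtx n M (R' + R + 2) β' x then ‖v x‖ ^ 2 else 0)
      ≤ cP * dirOn (univ : Finset (Fin d → Fin (n₀ + 1))) (v ∘ chart (fine n M) (n := n₀) (vtxBase n M m (2 ^ J * m) β')) :=
    fun β' hβ' => sum_nearVtx_normSq_le_dirOn hmK h4m hn₀ (r := R' + R + 2) (by omega) S hz β' (sigAct M S β') (sigAct_spec S hβ')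
  -- pointwise: a transition site has `etaC ≠ 0` at `x + e_ν` or at `x`
  have hpt : ∀ ν x, (if etaC n M S μ R R' (x + unitVec (fine n M) ν) ≠ etaC n M S μ R R' x then ‖v x‖ ^ 2 else 0)
      ≤ (if etaC n M S μ R R' (x + unitVec (fine n M) ν) ≠ 0 then ‖v x‖ ^ 2 else 0)
        + (if etaC n M S μ R R' x ≠ 0 then ‖v x‖ ^ 2 else 0) := by
    intro ν x
    by_cases h : etaC n M S μ R R' (x + unitVec (fine n M) ν) ≠ etaC n M S μ R R' x
    · rw [if_pos h]
      by_cases h1 : etaC n M S μ R R' (x + unitVec (fine n M) ν) ≠ 0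
      · rw [if_pos h1]; exact le_add_of_nonneg_right (ite_nonneg (sq_nonneg _) le_rfl)
      · have h1' : etaC n M S μ R R' (x + unitVec (fine n M) ν) = 0 := not_not.mp h1
        have h2 : etaC n M S μ R R' x ≠ 0 := fun h2 => h (by rw [h1', h2])
        rw [if_neg h1, if_pos h2, zero_add]
    · rw [if_neg h]; positivity
  have hsum : ∀ ν : Fin d, ∑ x, (if etaC n M S μ R R' (x + unitVec (fine n M) ν) ≠ etaC n M S μ R R' x then ‖v x‖ ^ 2 else 0)
      ≤ 2 * ∑ β' ∈ ActV M S, ∑ x, (if NearVtx n M (R' + R + 2) β' x then ‖v x‖ ^ 2 else 0) := by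
    intro ν
    calc ∑ x, (if etaC n M S μ R R' (x + unitVec (fine n M) ν) ≠ etaC n M S μ R R' x then ‖v x‖ ^ 2 else 0)
        ≤ ∑ x, (∑ β' ∈ ActV M S, (if NearVtx n M (R' + R + 2) β' x then ‖v x‖ ^ 2 else 0)
            + ∑ β' ∈ ActV M S, (if NearVtx n M (R' + R + 2) β' x then ‖v x‖ ^ 2 else 0)) :=
          Finset.sum_le_sum fun x _ => (hpt ν x).trans
            (add_le_add (ite_etaC_add_le hd hR hρn x ν (sq_nonneg _)) (ite_etaC_le hd hR x (sq_nonneg _)))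
      _ = 2 * ∑ β' ∈ ActV M S, ∑ x, (if NearVtx n M (R' + R + 2) β' x then ‖v x‖ ^ 2 else 0) := by
          rw [Finset.sum_add_distrib, ← two_mul, Finset.sum_comm]
  have hA : ∑ β' ∈ ActV M S, ∑ x, (if NearVtx n M (R' + R + 2) β' x then ‖v x‖ ^ 2 else 0)
      ≤ cP / (n : ℝ) ^ 2 * (theta d ^ J * Cdec d a' * nsq w) := by
    calc ∑ β' ∈ ActV M S, ∑ x, (if NearVtx n M (R' + R + 2) β' x then ‖v x‖ ^ 2 else 0)
        ≤ ∑ β' ∈ ActV M S, cP * dirOn (univ : Finset (Fin d → Fin (n₀ + 1))) (v ∘ chart (fine n M) (n := n₀) (vtxBase n M m (2 ^ J * m) β')) :=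
          Finset.sum_le_sum hone
      _ = cP / (n : ℝ) ^ 2 * ∑ β' ∈ ActV M S, (n : ℝ) ^ 2
            * dirOn (univ : Finset (Fin d → Fin (n₀ + 1))) (v ∘ chart (fine n M) (n := n₀) (vtxBase n M m (2 ^ J * m) β')) := by
          rw [Finset.mul_sum]
          refine Finset.sum_congr rfl fun β' _ => ?_
          field_simp
      _ ≤ cP / (n : ℝ) ^ 2 * (theta d ^ J * Cdec d a' * nsq w) := by
          refine mul_le_mul_of_nonneg_left ?_ (by positivity)
          rw [Cdec]; exact hdec
  calc Mloc n M S μ R R' v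
      = ∑ ν : Fin d, ∑ x, (if etaC n M S μ R R' (x + unitVec (fine n M) ν) ≠ etaC n M S μ R R' x then ‖v x‖ ^ 2 else 0) := rfl
    _ ≤ ∑ _ν : Fin d, 2 * (cP / (n : ℝ) ^ 2 * (theta d ^ J * Cdec d a' * nsq w)) :=
        Finset.sum_le_sum fun ν _ => (hsum ν).trans (by linarith [hA])
    _ = 2 * d * ((1 + 2 ^ d) * ((n₀ : ℝ) * (n₀ + 1) / 2)) / (n : ℝ) ^ 2 * (theta d ^ J * Cdec d a' * nsq w) := by
        rw [Finset.sum_const, Finset.card_univ, Fintype.card_fin, nsmul_eq_mul, hcP]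
        ring

end Decay

/-! ## The END: the second-difference budget on every union of blocks (`d = 3`) -/

section End

variable {S : Tor M → Prop} [DecidablePred S] {μ : Fin d} {R R' : ℕ} (hd : d = 3) (hR : 2 ≤ R) (hn4 : 4 * R ≤ n) (hRR : 2 * R + 2 ≤ R')
  (hn : 2 * (R' + R) ≤ n) {a' : ℝ} (ha' : 0 < a') {m : ℕ} (hr : R' + R + 4 ≤ 2 * m) (h4m : 4 * m ≤ n) {n₀ : ℕ} (hn₀ : 4 * m = n₀ + 1)
  (J : ℕ) {nn : ℕ} (hnn : 4 * (2 ^ J * m) = nn + 1) (hK : 2 * (2 ^ J * m) ≤ n) (hN' : ∀ ν, nn + 1 ≤ fine n M ν)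
include hd hR hn4 hRR hn ha' hr h4m hn₀ hnn hK hN'

/-- **THE SECOND-DIFFERENCE BUDGET OF THE REGION DIRICHLET SOLUTION ON AN ARBITRARY UNION OF UNIT BLOCKS (`d = 3`).**  For every block set
`S`, axis `μ`, datum `w`, and free scales `2 ≤ R`, `4R ≤ n`, `2R + 2 ≤ R′`, `2(R′+R) ≤ n`, `R′ + R + 4 ≤ 2m`, `4m = n₀ + 1 ≤ n`, `K = 2^J m`,
`2K ≤ n`, `4K = nn + 1 ≤ n·M ν`:
`‖∂_μᴴ∂_μ v‖² ≤ (16n·A₁A₂ + 16n²·θ_d^J·Cdec·(1 + d(1+2^d)·ell1C²·n₀(n₀+1)))·‖w‖²`, `v = solExt n M a′ (blockReg S) w`. [folklore] -/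
theorem nsq_sdiffH_sdiff_solExt_le_budget (w : {x // blockReg n M S x} → ℂ) :
    nsq ((sdiff (fine n M) (n : ℂ) μ)ᴴ *ᵥ (sdiff (fine n M) (n : ℂ) μ *ᵥ solExt n M a' (blockReg n M S) w))
      ≤ (16 * n * A1 d a' n R * A2 d a' n R
          + 16 * (n : ℝ) ^ 2 * (theta d ^ J * Cdec d a') * (1 + d * (1 + 2 ^ d) * ell1C d R ^ 2 * ((n₀ : ℝ) * (n₀ + 1)))) * nsq w := by
  have hR' : 2 ≤ R' := by omega
  have hρn : R' + R + 2 ≤ n := by omega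
  have hnpos : (0 : ℝ) < n := by exact_mod_cast Nat.pos_of_ne_zero (NeZero.ne n)
  have hsplit := nsq_sdiffH_sdiff_solExt_le_split hR hR' hn (S := S) (μ := μ) hn4 hRR ha' w
  have hE := Eloc_le hd hR hρn ha' hr h4m hn₀ J hnn hK hN' (S := S) (μ := μ) w
  have hM' := Mloc_le hd hR hρn ha' hr h4m hn₀ J hnn hK hN' (S := S) (μ := μ) w
  refine hsplit.trans ?_
  have hθC : 0 ≤ theta d ^ J * Cdec d a' * nsq w :=
    mul_nonneg (mul_nonneg (pow_nonneg (by linarith [(theta_lt_one d).1]) J) (Cdec_nonneg d a')) (nsq_nonneg w)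
  have hl : 0 ≤ ell1C d R ^ 2 := sq_nonneg _
  have hmass : 2 * (n : ℝ) ^ 2 * ell1C d R ^ 2 * Mloc n M S μ R R' (solExt n M a' (blockReg n M S) w)
      ≤ 2 * ell1C d R ^ 2 * (2 * d * ((1 + 2 ^ d) * ((n₀ : ℝ) * (n₀ + 1) / 2))) * (theta d ^ J * Cdec d a' * nsq w) := by
    have h := mul_le_mul_of_nonneg_left hM' (by positivity : (0 : ℝ) ≤ 2 * (n : ℝ) ^ 2 * ell1C d R ^ 2)
    refine h.trans (le_of_eq ?_)
    field_simp
  nlinarith [hE, hmass, hθC, hl, sq_nonneg (n : ℝ)]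

end End

end Summit.QuantumFields.BalabanUV.T4Continuum.DirichletCutoutNearDecay

end
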